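import Summits.ABC.ABC.Theorems.DefiniteXiFreyModularityStubAbsIrrNegThree
import Literature.NumberTheory.EllipticCurves.OpenImageMazurFrobeniusProofs
import Literature.NumberTheory.EllipticCurves.OpenImageMazurAssemblyProofs
import Literature.NumberTheory.EllipticCurves.SemistableModPImageReducibleProofs
import Literature.NumberTheory.GaloisRepresentations.IntegralGaloisActionProofs
import Literature.NumberTheory.EllipticCurves.BSDConductorProofs
import HarnessLib

/-!
# Crux `FreyModularity` (stmt-ABC-11340), line `Sketch`, reshape 3: `ρ̄_{E,5}` is irreducible for
# the Frey curves with `3 ∤ abc` (the `Frob₃` argument; covers the `j = 1728` exception `E_(−1,2)`)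

Helper toward the registered glue stub `stub_freyFiveIrreducibleGlue` of the line `Sketch`
(`Summits/ABC/ABC/Cruxes/FreyModularity/Lines/Sketch.lean`).  For a Frey curve
`E_(a,b) : y² = x(x − a)(x + b)` with `3 ∤ ab(a+b)` the three roots `0, a, −b` are the three
elements of `𝔽₃`, so `E` has good reduction `y² = x³ − x` at `3` with `a₃ = 0` (tree:
`Summit.ABC.ABC.Theorems.frobeniusTrace_three_smul_freyCurve`, on a global minimal model).  If
`E[5]` had a `Γ_ℚ`-stable line `𝔽₅ P` with isogeny character `r` (Mazur 1978 §5), an arithmetic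
Frobenius `φ` at a prime above `3` would satisfy `r(φ)² − a₃ r(φ) + 3 = 0` in `𝔽₅` (Mazur 1978,
Prop. 6.3 (1); tree: `Mazur1978.isogenyCharacter_sq_sub_frobeniusTrace_mul_add_eq_zero`), i.e.
`r(φ)² = 2` — but `2` is not a square modulo `5`.  Hence `ρ̄_{E,5}` is irreducible.  This is the
classical "supersingular Frobenius has irreducible characteristic polynomial" observation; it is
used by the glue for the single normalised Frey curve `E_(−1,2) ≅ (y² = x³ − x)` (`j = 1728`,
`c₆ = 0`) that the Swan-conductor class theorems do not cover, and it settles outright every Frey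
curve with `3 ∤ abc`.

* `stub_glue_notThreeDvd` — the registered helper stub: `3 ∤ ab(a+b)` ⇒
  `(freyCurve a b).HasIrreducibleModPGaloisRep 5`.
-/

-- `Summit.<Summit>.<Problem>` is the mandated summit-side namespace (CONVENTIONS §2); for the
-- single-conjunct summit `ABC` the two coincide, so the duplicate `ABC.ABC` is deliberate.
set_option linter.dupNamespace false

noncomputable section

open scoped NumberField

open Literature.NumberTheory.EllipticCurves
open Literature.NumberTheory.GaloisRepresentations
open WeierstrassCurve IsDedekindDomain Field

namespace Summit.ABC.ABC.Theorems

/-- `X² + 3` has no root in `𝔽₅` (`2` is not a square modulo `5`). [folklore] -/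
theorem zmod_five_sq_add_three_ne_zero (x : ZMod 5) : x ^ 2 + 3 ≠ 0 := by
  revert x; decide

/-- **A globally minimal elliptic curve over `ℚ` with good reduction at `3` and `a₃ = 0` has
irreducible `ρ̄_{E,5}`**: a `Γ_ℚ`-stable line `𝔽₅ P ⊂ E[5]` has an isogeny character `r`
(`Mazur1978.exists_isogenyCharacter`), and at an arithmetic Frobenius `φ` above `3`,
`r(φ)² − a₃ r(φ) + 3 = 0` in `𝔽₅` (Mazur 1978, Prop. 6.3 (1)), impossible for `a₃ = 0`.
[cite: Mazur1978, §6 Prop. 6.3 (1) and its proof (p. 153)] -/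
theorem hasIrreducibleModPGaloisRep_five_of_frobeniusTrace_three_eq_zero (W : WeierstrassCurve ℚ)
    [W.IsElliptic] [W.IsGloballyMinimal] (hgood : W.HasGoodReductionAtPrime 3)
    (htr : W.frobeniusTrace 3 = 0) : W.HasIrreducibleModPGaloisRep 5 := by
  haveI : Fact (Nat.Prime 5) := ⟨Nat.prime_five⟩
  haveI : Fact (Nat.Prime 3) := ⟨Nat.prime_three⟩
  intro H hst
  by_contra hH
  push Not at hH
  obtain ⟨hbot, htop⟩ := hH
  obtain ⟨P, hPH, hP0, hHP⟩ := exists_eq_zmultiples_of_ne_bot_of_ne_top W 5 H hbot htop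
  have hstP : ∀ σ : absoluteGaloisGroup ℚ, σ • P ∈ AddSubgroup.zmultiples P := fun σ ↦
    hHP ▸ hst σ P hPH
  obtain ⟨r, hr⟩ := Mazur1978.exists_isogenyCharacter W 5 hP0 hstP
  -- the place of `ℚ` above `3`, a prime `𝔓` of `\bar ℤ` above it and a Frobenius there
  set v : HeightOneSpectrum (𝓞 ℚ) :=
    (Rat.HeightOneSpectrum.primesEquiv (R := 𝓞 ℚ)).symm ⟨3, Nat.prime_three⟩ with hvdef
  have hv3 : (Rat.HeightOneSpectrum.primesEquiv v : ℕ) = 3 := by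
    rw [hvdef, Equiv.apply_symm_apply]
  have hv : ((3 : ℕ) : 𝓞 ℚ) ∈ v.asIdeal :=
    (natCast_mem_asIdeal_iff_eq_primesEquiv_symm v Nat.prime_three).mpr hvdef
  obtain ⟨𝔓, h𝔓⟩ := HeightOneSpectrum.primesAbove_nonempty v
  obtain ⟨φ, hφ⟩ := HeightOneSpectrum.exists_isArithFrobAt_of_mem_primesAbove_holds (v := v) h𝔓
  have h := Mazur1978.isogenyCharacter_sq_sub_frobeniusTrace_mul_add_eq_zero W 5 3 (by decide)
    hgood hP0 hr hv h𝔓 hφ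
  rw [htr] at h
  simp only [Int.cast_zero, zero_mul, sub_zero] at h
  exact zmod_five_sq_add_three_ne_zero _ (by exact_mod_cast h)

/-- **Helper stub `stub_glue_notThreeDvd` of the line `Sketch` (reshape 3): `ρ̄_{E,5}` is
irreducible for every Frey curve `E_(a,b)` with `ab(a+b) ≠ 0` and `3 ∤ ab(a+b)`** (coprimality is
part of the registered signature but not used).  On a global minimal model `C • E_(a,b)`
(`hasGlobalMinimalModel_rat_holds`) the curve has good reduction at `3` with `a₃ = 0`
(`frobeniusTrace_three_smul_freyCurve`), so `hasIrreducibleModPGaloisRep_five_of_frobeniusTrace_three_eq_zero`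
applies, and irreducibility is invariant under the change of equation
(`Mazur1978.hasIrreducibleModPGaloisRep_smul_iff`).  In particular for the normalised Frey curve
`E_(−1,2) ≅ (y² = x³ − x)` (`j = 1728`). [cite: Mazur1978, §6 Prop. 6.3 (1)] -/
theorem stub_glue_notThreeDvd :
    ∀ a b : ℤ, IsCoprime a b → a * b * (a + b) ≠ 0 → ¬ (3 : ℤ) ∣ a * b * (a + b) →
      (freyCurve a b).HasIrreducibleModPGaloisRep 5 := by
  intro a b _ h0 h3
  haveI := isElliptic_freyCurve h0
  obtain ⟨C, hC⟩ := hasGlobalMinimalModel_rat_holds (freyCurve a b)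
  haveI := hC
  obtain ⟨hgood, htr⟩ := frobeniusTrace_three_smul_freyCurve h0 h3 C
  exact (Mazur1978.hasIrreducibleModPGaloisRep_smul_iff (freyCurve a b) C 5).mp
    (hasIrreducibleModPGaloisRep_five_of_frobeniusTrace_three_eq_zero (C • freyCurve a b) hgood htr)

end Summit.ABC.ABC.Theorems

end
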